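import Literature.Analysis.FluidPDE.NormalisedPressureLpBoundProofs
import Literature.Analysis.FluidPDE.HessianLaplacianLp
import Mathlib.MeasureTheory.Function.LpSpace.Complete
import HarnessLib

/-!
# Stein's `L^p` bound for the Hessian by the Laplacian on `ℝ³`: discharge of the named fact

Analysis/FluidPDE proof file; sibling of `HessianLaplacianLp` (the named fact
`Literature.Analysis.FluidPDE.stein1970_hessian_Lp_bound E`: E. M. Stein, *Singular integrals*
(1970), Ch. III §1.3 **Proposition 3**, p. 59 — for `f ∈ C²` with compact support,
`‖∂ⱼ∂ₖ f‖_p ≤ A_p ‖Δf‖_p`, `1 < p < ∞`). This file PROVES the fact on physical space,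

* `stein1970_hessian_Lp_bound_holds_fin3 : stein1970_hessian_Lp_bound (EuclideanSpace ℝ (Fin 3))`,

from the Calderón–Zygmund `L^p` theory now proved in the tree
(`Literature/Analysis/SingularIntegrals/`, Stein 1970 Ch. I §3–4, Ch. II §2–3) through its
consequence `exists_eLpNorm_hessConv_le` (`FluidPDE/NormalisedPressureLpBoundProofs`): ONE
constant `C_p` with `‖H^a_ε[h]‖_p ≤ C_p ‖h‖_p` for all `ε > 0`, `|a| ≤ 2`, `h ∈ C_c(ℝ³)`, where
`H^a_ε[h] = ∫ h(t) ∂ₐ∂ₐΦ_ε(· - t) dt` (`hessConv`) is the Hessian convolution with the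
regularised Newtonian kernel `Φ_ε` (`newtonReg`, `FluidPDE/NormalisedPressureL2Bound`).

## The argument (Stein 1970, Ch. III §1.3: `∂ⱼ∂ₖf = -RⱼRₖΔf`, here without Fourier transform)

For `f ∈ C²_c(ℝ³)` and `ε > 0`, Green's second identity, `Δ∂ₐ∂ₐΦ_ε = ∂ₐ∂ₐΔΦ_ε = ∂ₐ∂ₐλ_ε`
(`λ_ε = ΔΦ_ε = λ_{ε/2,ε}`, the tree's smooth compactly supported unit-mass bump) and two
integrations by parts give the exact identity

  `H^a_ε[Δf](x) = ∫ λ_ε(z) ∂ₐ∂ₐf(x - z) dz`   (`hessConv_laplacian_eq`),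

i.e. the regularised operator `∂ₐ∂ₐΔ⁻¹` applied to `Δf` is the mollification of `∂ₐ∂ₐf` at scale
`ε`. The rescaled `λ`'s are an approximate identity (`tendsto_integral_newtonFarLaplacian_smul`),
so `H^a_ε[Δf] → ∂ₐ∂ₐf` pointwise as `ε → 0⁺` (`tendsto_hessConv_laplacian`); by Fatou
(`eLpNorm_lim_le_liminf_eLpNorm`) and the uniform bound, `‖∂ₐ∂ₐf‖_p ≤ C_p ‖Δf‖_p` for `|a| ≤ 2`
(`exists_eLpNorm_fderiv_fderiv_le`). Mixed directions `|a|, |b| ≤ 1` follow by polarisation,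
`∂_b∂ₐ f = ¼(∂²_{a+b} f − ∂²_{a−b} f)` (Schwarz), with constant `2C_p`.

## Consequences

With this discharge the interior Stokes estimate of Tsai 1998 (3.2) becomes unconditional:
`stokes_interior_Lr_estimate_holds` (`FluidPDE/StokesInteriorEstimateHolds`, from
`stokes_interior_Lr_estimate_of_hessian`, `FluidPDE/StokesInteriorEstimateProofs`).

## References

* E. M. Stein, *Singular integrals and differentiability properties of functions*, Princeton
  Math. Series 30 (1970), Ch. III §1.3, Proposition 3 (p. 59; p. 53 of the held scan); Ch. II
  §3.2 Theorem 2, §4.2 Theorem 3. [`Stein1971`]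
-/

noncomputable section

open MeasureTheory Set Filter Topology Function Metric InnerProductSpace
open scoped ENNReal NNReal RealInnerProductSpace Laplacian ContDiff

namespace Literature.Analysis.FluidPDE

/-! ### The regularised Riesz identity `H^a_ε[Δf] = λ_ε * ∂ₐ∂ₐf` -/

/-- **`H^a_ε[Δf](x) = ∫ λ_{ε/2,ε}(z) ∂ₐ∂ₐf(x - z) dz`** for `f ∈ C²_c(ℝ³)`, `ε > 0`: Green's second
identity moves `Δ` from `f` onto the kernel `∂ₐ∂ₐΦ_ε(x - ·)`, `Δ∂ₐ∂ₐΦ_ε = ∂ₐ∂ₐ(ΔΦ_ε)`, two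
integrations by parts move `∂ₐ∂ₐ` back onto `f`, and `ΔΦ_ε = λ_{ε/2,ε}`
(`laplacian_newtonReg`). [folklore] -/
theorem hessConv_laplacian_eq {ε : ℝ} (hε : 0 < ε) {f : EuclideanSpace ℝ (Fin 3) → ℝ}
    (hf : ContDiff ℝ 2 f) (hfc : HasCompactSupport f) (a x : EuclideanSpace ℝ (Fin 3)) :
    hessConv ε (Δ f) a x = ∫ z, newtonFarLaplacian (ε / 2) ε z *
      fderiv ℝ (fun s => fderiv ℝ f s a) (x - z) a := by
  set Φ : EuclideanSpace ℝ (Fin 3) → ℝ := newtonReg ε with hΦ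
  have hΦ4 : ContDiff ℝ 4 Φ := contDiff_newtonReg ε
  have hΦ3 : ContDiff ℝ 3 Φ := contDiff_newtonReg ε
  have hg3 : ContDiff ℝ 3 (fun s => fderiv ℝ Φ s a) :=
    (hΦ4.fderiv_right (m := 3) (by norm_num)).clm_apply contDiff_const
  set k : EuclideanSpace ℝ (Fin 3) → ℝ := fun z => fderiv ℝ (fun s => fderiv ℝ Φ s a) z a with hk
  have hk2 : ContDiff ℝ 2 k := (hg3.fderiv_right (m := 2) (by norm_num)).clm_apply contDiff_const
  have hΔΦ2 : ContDiff ℝ 2 (Δ Φ) := contDiff_laplacian (n := 2) (by exact_mod_cast hΦ4)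
  -- Step 1: Green's second identity
  have s1 : hessConv ε (Δ f) a x = ∫ t, f t * (Δ (fun z => k (x - z))) t := by
    have h := integral_mul_laplacian_comm (f := fun z => k (x - z)) (g := f)
      (contDiff_comp_const_sub hk2 x) hf hfc
    rw [hessConv]
    calc ∫ t, (Δ f) t * fderiv ℝ (fun s => fderiv ℝ (newtonReg ε) s a) (x - t) a
        = ∫ t, (Δ f) t * (fun z => k (x - z)) t := rfl
      _ = ∫ t, f t * (Δ (fun z => k (x - z))) t := h.symm
  -- Step 2: `Δ` commutes with the reflection-translation
  have s2 : ∀ t, (Δ (fun z => k (x - z))) t = (Δ k) (x - t) := fun t => laplacian_comp_sub_left hk2 x t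
  -- Step 3: `Δ∂ₐ∂ₐΦ = ∂ₐ∂ₐΔΦ`
  have s3 : ∀ z, (Δ k) z = fderiv ℝ (fun s => fderiv ℝ (Δ Φ) s a) z a := by
    intro z
    have e1 : (Δ (fun s => fderiv ℝ Φ s a)) = fun s => fderiv ℝ (Δ Φ) s a :=
      funext fun s => (fderiv_laplacian_apply hΦ3 s a).symm
    rw [hk, ← fderiv_laplacian_apply hg3 z a, e1]
  -- Step 4: two integrations by parts back onto `f`
  have s4 : ∫ t, f t * fderiv ℝ (fun s => fderiv ℝ (Δ Φ) s a) (x - t) a =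
      ∫ t, (Δ Φ) (x - t) * fderiv ℝ (fun s => fderiv ℝ f s a) t a := by
    rw [integral_comp_sub_mul_fderiv_fderiv_apply hΔΦ2 hf hfc x a]
    exact integral_congr_ae (Eventually.of_forall fun t => mul_comm _ _)
  -- Step 5: the substitution `t ↦ x - t`
  have s5 : ∫ t, (Δ Φ) (x - t) * fderiv ℝ (fun s => fderiv ℝ f s a) t a =
      ∫ z, (Δ Φ) z * fderiv ℝ (fun s => fderiv ℝ f s a) (x - z) a := by
    have h := (integral_sub_left_eq_self
      (fun t => (Δ Φ) (x - t) * fderiv ℝ (fun s => fderiv ℝ f s a) t a) volume x).symm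
    simpa only [sub_sub_cancel] using h
  calc hessConv ε (Δ f) a x = ∫ t, f t * (Δ k) (x - t) := by
        rw [s1]
        exact integral_congr_ae (Eventually.of_forall fun t => by
          dsimp only
          rw [s2])
    _ = ∫ t, f t * fderiv ℝ (fun s => fderiv ℝ (Δ Φ) s a) (x - t) a :=
        integral_congr_ae (Eventually.of_forall fun t => by
          dsimp only
          rw [s3])
    _ = ∫ z, (Δ Φ) z * fderiv ℝ (fun s => fderiv ℝ f s a) (x - z) a := by rw [s4, s5]
    _ = ∫ z, newtonFarLaplacian (ε / 2) ε z * fderiv ℝ (fun s => fderiv ℝ f s a) (x - z) a := by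
        rw [hΦ, laplacian_newtonReg hε]

/-- **`H^a_ε[Δf] → ∂ₐ∂ₐf` pointwise as `ε → 0⁺`** for `f ∈ C²_c(ℝ³)` (the rescaled `λ`'s are an
approximate identity, `tendsto_integral_newtonFarLaplacian_smul`). [folklore] -/
theorem tendsto_hessConv_laplacian {f : EuclideanSpace ℝ (Fin 3) → ℝ} (hf : ContDiff ℝ 2 f)
    (hfc : HasCompactSupport f) (a x : EuclideanSpace ℝ (Fin 3)) :
    Tendsto (fun ε => hessConv ε (Δ f) a x) (𝓝[>] 0)
      (𝓝 (fderiv ℝ (fun s => fderiv ℝ f s a) x a)) := by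
  have hφ : Continuous fun z : EuclideanSpace ℝ (Fin 3) =>
      fderiv ℝ (fun s => fderiv ℝ f s a) (x - z) a :=
    (FluidPDE.continuous_fderiv_fderiv_apply hf a a).comp (continuous_const.sub continuous_id)
  have h := tendsto_integral_newtonFarLaplacian_smul (r₀ := 1 / 2) (r₁ := 1) (by norm_num)
    (by norm_num) hφ
  simp only [sub_zero, smul_eq_mul, mul_one] at h
  refine h.congr' ?_
  filter_upwards [self_mem_nhdsWithin] with ε hε
  rw [hessConv_laplacian_eq hε hf hfc a x, show ε * (1 / 2) = ε / 2 by ring]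

/-- **The diagonal bound `‖∂ₐ∂ₐf‖_p ≤ C_p ‖Δf‖_p`** for `f ∈ C²_c(ℝ³)`, `|a| ≤ 2`, `1 < p < ∞`,
with the constant of `exists_eLpNorm_hessConv_le` (Calderón–Zygmund): Fatou along
`ε = 1/(n+1)` in `H^a_ε[Δf] → ∂ₐ∂ₐf`. [cite: Stein1971, Ch. III §1.3 Prop 3] -/
theorem exists_eLpNorm_fderiv_fderiv_le {p : ℝ≥0∞} (hp : 1 < p) (hp' : p < ⊤) :
    ∃ C : ℝ≥0, ∀ f : EuclideanSpace ℝ (Fin 3) → ℝ, ContDiff ℝ 2 f → HasCompactSupport f →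
      ∀ a : EuclideanSpace ℝ (Fin 3), ‖a‖ ≤ 2 →
        eLpNorm (fun x => fderiv ℝ (fun s => fderiv ℝ f s a) x a) p volume ≤
          C * eLpNorm (Δ f) p volume := by
  obtain ⟨C, hC⟩ := exists_eLpNorm_hessConv_le hp hp'
  refine ⟨C, fun f hf hfc a ha => ?_⟩
  have hΔc : Continuous (Δ f) := continuous_laplacian hf
  have hΔcs : HasCompactSupport (Δ f) :=
    HasCompactSupport.intro hfc fun x hx => laplacian_eq_zero_of_notMem_tsupport hx
  set u : ℕ → EuclideanSpace ℝ (Fin 3) → ℝ := fun n => hessConv (1 / ((n : ℝ) + 1)) (Δ f) a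
    with hu
  have hmeas : ∀ n, AEStronglyMeasurable (u n) volume := fun n =>
    aestronglyMeasurable_hessConv _ hΔc a
  have hseq : Tendsto (fun n : ℕ => 1 / ((n : ℝ) + 1)) atTop (𝓝[>] 0) :=
    tendsto_nhdsWithin_iff.2 ⟨tendsto_one_div_add_atTop_nhds_zero_nat,
      Eventually.of_forall fun n => mem_Ioi.2 (one_div_pos.2 (Nat.cast_add_one_pos n))⟩
  have hlim : ∀ x, Tendsto (fun n => u n x) atTop
      (𝓝 (fderiv ℝ (fun s => fderiv ℝ f s a) x a)) := fun x =>
    (tendsto_hessConv_laplacian hf hfc a x).comp hseq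
  have hfatou := Lp.eLpNorm_lim_le_liminf_eLpNorm (p := p) hmeas
    (fun x => fderiv ℝ (fun s => fderiv ℝ f s a) x a) (Eventually.of_forall hlim)
  have hbound : ∀ n, eLpNorm (u n) p volume ≤ C * eLpNorm (Δ f) p volume := fun n =>
    hC _ (one_div_pos.2 (Nat.cast_add_one_pos n)) a ha (Δ f) hΔc hΔcs
  exact hfatou.trans (Filter.liminf_le_of_frequently_le' (Eventually.of_forall hbound).frequently)

/-! ### The discharge -/

/-- **Discharge of `stein1970_hessian_Lp_bound` on `ℝ³`** (Stein 1970, Ch. III §1.3,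
Proposition 3, p. 59): for every `1 < p < ∞` there is `A = A_p` such that for every
`f ∈ C²(ℝ³)` with compact support and all directions `|a|, |b| ≤ 1`,
`‖∂_b∂ₐ f‖_{L^p(ℝ³)} ≤ A ‖Δf‖_{L^p(ℝ³)}`. PROVED: the diagonal case is
`exists_eLpNorm_fderiv_fderiv_le` (Calderón–Zygmund theory of the tree, through the regularised
Hessian convolutions of the Newtonian kernel), the mixed case follows by polarisation
`∂_b∂ₐ f = ¼(∂²_{a+b} f − ∂²_{a−b} f)` (Schwarz's theorem) with `A = 2C_p`.
[cite: Stein1971, Ch. III §1.3 Prop 3] -/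
theorem stein1970_hessian_Lp_bound_holds_fin3 :
    stein1970_hessian_Lp_bound (EuclideanSpace ℝ (Fin 3)) := by
  intro p hp hp'
  obtain ⟨C, hC⟩ := exists_eLpNorm_fderiv_fderiv_le hp hp'
  refine ⟨2 * C, fun f hf hfc a b ha hb => ?_⟩
  -- polarisation
  set g₁ : EuclideanSpace ℝ (Fin 3) → ℝ := fun x => fderiv ℝ (fun y => fderiv ℝ f y (a + b)) x (a + b)
    with hg₁
  set g₂ : EuclideanSpace ℝ (Fin 3) → ℝ := fun x => fderiv ℝ (fun y => fderiv ℝ f y (a - b)) x (a - b)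
    with hg₂
  have hpol : (fun x => fderiv ℝ (fun y => fderiv ℝ f y a) x b) = (1 / 4 : ℝ) • (g₁ - g₂) := by
    funext x
    have hD : Differentiable ℝ (fderiv ℝ f) :=
      (hf.fderiv_right (m := 1) le_rfl).differentiable one_ne_zero
    have key : ∀ u v, fderiv ℝ (fun y => fderiv ℝ f y u) x v = fderiv ℝ (fderiv ℝ f) x v u :=
      fun u v => fderiv_apply_const_apply (hD x) u v
    have hsymm : fderiv ℝ (fderiv ℝ f) x a b = fderiv ℝ (fderiv ℝ f) x b a :=
      (hf.contDiffAt.isSymmSndFDerivAt (n := 2) (by simp)) a b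
    have e0 : fderiv ℝ (fun y => fderiv ℝ f y a) x b = fderiv ℝ (fderiv ℝ f) x b a := key a b
    have e1 : g₁ x = fderiv ℝ (fderiv ℝ f) x (a + b) (a + b) := key (a + b) (a + b)
    have e2 : g₂ x = fderiv ℝ (fderiv ℝ f) x (a - b) (a - b) := key (a - b) (a - b)
    rw [Pi.smul_apply, Pi.sub_apply, e0, e1, e2, smul_eq_mul]
    simp only [map_add, map_sub, _root_.add_apply, _root_.sub_apply]
    linarith [hsymm]
  have hab : ‖a + b‖ ≤ 2 := (norm_add_le _ _).trans (by linarith)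
  have hab' : ‖a - b‖ ≤ 2 := (norm_sub_le _ _).trans (by linarith)
  have h1 : eLpNorm g₁ p volume ≤ C * eLpNorm (Δ f) p volume := hC f hf hfc (a + b) hab
  have h2 : eLpNorm g₂ p volume ≤ C * eLpNorm (Δ f) p volume := hC f hf hfc (a - b) hab'
  have hm1 : AEStronglyMeasurable g₁ volume :=
    (FluidPDE.continuous_fderiv_fderiv_apply hf (a + b) (a + b)).aestronglyMeasurable
  have hm2 : AEStronglyMeasurable g₂ volume :=
    (FluidPDE.continuous_fderiv_fderiv_apply hf (a - b) (a - b)).aestronglyMeasurable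
  have hquarter : ‖(1 / 4 : ℝ)‖ₑ ≤ 1 := by
    rw [Real.enorm_eq_ofReal (by norm_num)]
    exact ENNReal.ofReal_le_one.2 (by norm_num)
  rw [hpol]
  calc eLpNorm ((1 / 4 : ℝ) • (g₁ - g₂)) p volume
      ≤ ‖(1 / 4 : ℝ)‖ₑ * eLpNorm (g₁ - g₂) p volume := eLpNorm_const_smul_le
    _ ≤ ‖(1 / 4 : ℝ)‖ₑ * (eLpNorm g₁ p volume + eLpNorm g₂ p volume) := by
        gcongr
        exact eLpNorm_sub_le hm1 hm2 hp.le
    _ ≤ 1 * (C * eLpNorm (Δ f) p volume + C * eLpNorm (Δ f) p volume) := by gcongr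
    _ = ↑(2 * C) * eLpNorm (Δ f) p volume := by
        push_cast
        ring

end Literature.Analysis.FluidPDE

end
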